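import Literature.NumberTheory.EllipticCurves.WeierstrassPDivisionValuesAtImInfty
import Literature.NumberTheory.EllipticCurves.WeierstrassPDivisionCharacterQExpansion
import Literature.NumberTheory.EllipticCurves.EisensteinNewformLevelRaisingReductionProofs
import HarnessLib

/-!
# The weight-`2` Eisenstein series `E_2^{𝟙,χ}` of a primitive even character `χ ≠ 1`

Topic `Literature/NumberTheory/EllipticCurves`; namespace
`Literature.NumberTheory.EllipticCurves.ModularForms` (the form) and
`Literature.NumberTheory.EllipticCurves` (the corollary for Billerey–Menares 2018).

From the `℘`-division values `f_v` (`WeierstrassPDivisionValues`, holomorphic and bounded at every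
cusp by `WeierstrassPDivisionValuesAtImInfty`) we build, for every Dirichlet character `χ` modulo
`N`, the modular form of weight `2` on `Γ₁(N)`

  `eisensteinE2Char χ = (2 (-2πi)² W(χ̄))⁻¹ · S_χ`,  `S_χ(τ) = ∑_{e mod N} χ̄(e) ℘_{Λ_τ}(e/N)`

(`weierstrassPDivChar`).  For `χ` PRIMITIVE, `χ ≠ 1` and EVEN it is the Eisenstein series
`E_2^{𝟙,χ}` of Diamond–Shurman Thm. 4.6.2 / Miyake Thm. 7.2.12 (Billerey–Menares 2018, (7.1.3)
with `ψ = 𝟙`, `φ = χ`):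

* `eisensteinE2Char_slash_of_mem_gamma0` — `E ∣₂ γ = χ(d) E` for `γ = (a b; c d) ∈ Γ₀(N)`;
* `qExpansion_coeff_eisensteinE2Char` — `a_n(E) = σ_1^χ(n) = ∑_{d ∣ n} χ(d) d` (`n ≥ 1`) and
  `a_0(E) = -B_{2,χ}/4` (`WeierstrassPDivisionCharacterQExpansion` + `L(2, χ̄)` via
  `LFunction_eq_bernoulli`);
* `tendsto_eisensteinE2Char_slash_atImInfty` — the constant term of `E ∣₂ γ` at `i∞` is
  `-(B_{2,χ}/4) χ(d)` if `N ∣ c` and `0` otherwise (Billerey–Menares 2018, Prop. 4 with `M = 1`);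
* `exists_weightTwoEisenstein` — the statement `(E₂)` assumed by
  `BillereyMenares2018_exists_newform_of_cuspidalLift_of_weightTwoEisenstein`, whence
  `BillereyMenares2018_exists_newform_of_cuspidalLift`: Billerey–Menares 2018 Thm. 2 (⟸) with
  Thm. 1 reduced to the single cuspidal-lift input `(K)`.

## References

* F. Diamond, J. Shurman, *A First Course in Modular Forms*, GTM 228 (2005), §4.6, §4.8.
  [DiamondShurman2005]
* T. Miyake, *Modular Forms*, Springer (2006), Thm. 7.2.12. [Miyake2006]
* N. Billerey, R. Menares, *Strong modularity of reducible Galois representations*,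
  Trans. AMS 370 (2018), §1.3, Prop. 4, §3.2. [BillereyMenares2018]
-/

noncomputable section

open UpperHalfPlane EisensteinSeries ModularForm CongruenceSubgroup Complex Filter Function
  Literature.NumberTheory.LFunctions

open scoped Real MatrixGroups Topology Manifold

namespace Literature.NumberTheory.EllipticCurves.ModularForms

variable {N : ℕ} [NeZero N] (χ : DirichletCharacter ℂ N)

/-! ### `S_χ` slashed by an arbitrary `γ ∈ SL₂(ℤ)`: holomorphy, limits, boundedness -/

/-- Entries of `w γ` for `w ∈ ℤ²`. [folklore] -/
private theorem vecMul_fin_two' (w : Fin 2 → ℤ) (A : Matrix (Fin 2) (Fin 2) ℤ) (j : Fin 2) :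
    (Matrix.vecMul w A) j = w 0 * A 0 j + w 1 * A 1 j := by
  simp [Matrix.vecMul, dotProduct, Fin.sum_univ_two]

/-- **`S_χ ∣₂ γ = ∑_e χ̄(e) f_{(0,e)γ}`** for every `γ ∈ SL₂(ℤ)`. [cite: DiamondShurman2005, §4.6] -/
theorem weierstrassPDivChar_slash (γ : SL(2, ℤ)) :
    (weierstrassPDivChar χ) ∣[(2 : ℤ)] γ = fun τ ↦ ∑ e : ZMod N,
      χ⁻¹ e * weierstrassPDiv N (Matrix.vecMul ![0, (e.val : ℤ)] (γ : Matrix (Fin 2) (Fin 2) ℤ)) τ := by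
  funext τ
  simp only [ModularForm.SL_slash_apply, weierstrassPDivChar, Finset.sum_mul]
  refine Finset.sum_congr rfl fun e _ ↦ ?_
  have h := congr_fun (weierstrassPDiv_slash N ![0, (e.val : ℤ)] γ) τ
  rw [ModularForm.SL_slash_apply] at h
  rw [mul_assoc, h]

/-- `S_χ` is holomorphic on `ℍ`. [cite: DiamondShurman2005, §4.6] -/
theorem mdifferentiable_weierstrassPDivChar :
    MDifferentiable 𝓘(ℂ) 𝓘(ℂ) (weierstrassPDivChar χ) := by
  rw [UpperHalfPlane.mdifferentiable_iff]
  have h : (weierstrassPDivChar χ ∘ ofComplex) = fun z ↦ ∑ e : ZMod N,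
      χ⁻¹ e * (weierstrassPDiv N ![0, (e.val : ℤ)] ∘ ofComplex) z := by
    funext z
    simp [weierstrassPDivChar]
  rw [h]
  refine DifferentiableOn.fun_sum fun e _ ↦ DifferentiableOn.const_mul ?_ _
  exact UpperHalfPlane.mdifferentiable_iff.mp (mdifferentiable_weierstrassPDiv _)

/-- **The limit of `S_χ ∣₂ γ` at `i∞`** is `∑_e χ̄(e) K_{(0,e)γ}`. [cite: DiamondShurman2005, §4.6] -/
theorem tendsto_weierstrassPDivChar_slash_atImInfty (γ : SL(2, ℤ)) :
    Tendsto ((weierstrassPDivChar χ) ∣[(2 : ℤ)] γ) atImInfty (𝓝 (∑ e : ZMod N, χ⁻¹ e *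
      weierstrassPDivConst N (Matrix.vecMul ![0, (e.val : ℤ)] (γ : Matrix (Fin 2) (Fin 2) ℤ)))) := by
  rw [weierstrassPDivChar_slash]
  exact tendsto_finsetSum _ fun e _ ↦ (tendsto_weierstrassPDiv_atImInfty _).const_mul _

/-- **`S_χ ∣₂ γ` is bounded at `i∞` for every `γ ∈ SL₂(ℤ)`** (`S_χ` is bounded at every cusp).
[cite: DiamondShurman2005, §4.6] -/
theorem isBoundedAtImInfty_weierstrassPDivChar_slash (γ : SL(2, ℤ)) :
    IsBoundedAtImInfty ((weierstrassPDivChar χ) ∣[(2 : ℤ)] γ) :=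
  (tendsto_weierstrassPDivChar_slash_atImInfty χ γ).isBigO_one ℝ

/-! ### The constant terms at the cusps -/

omit [NeZero N] in
/-- The constant `∑_n (t - Nn)^{-2}` only depends on `t mod N`. [folklore] -/
theorem tsum_inv_sq_congr_mod {t t' : ℤ} (h : (t : ZMod N) = (t' : ZMod N)) :
    ∑' n : ℤ, (((t - N * n : ℤ) : ℂ) ^ 2)⁻¹ = ∑' n : ℤ, (((t' - N * n : ℤ) : ℂ) ^ 2)⁻¹ := by
  obtain ⟨w, hw⟩ := (ZMod.intCast_eq_intCast_iff_dvd_sub t t' N).1 h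
  rw [← (Equiv.addRight (-w)).tsum_eq]
  refine tsum_congr fun n ↦ ?_
  simp only [Equiv.coe_addRight]
  have : t - N * (n + -w) = t' - N * n := by linarith
  rw [this]

/-- `∑_{x mod N} χ̄(x) ∑_n (x̃ - Nn)^{-2} = ∑_{d ∈ ℤ} χ̄(d) d^{-2} = 2 L(2, χ̄)` (`χ` even).
[cite: DiamondShurman2005, §4.6] -/
theorem sum_inv_mul_tsum_inv_sq (heven : χ (-1) = 1) (τ : ℍ) :
    ∑ x : ZMod N, χ⁻¹ x * ∑' n : ℤ, (((x.val - N * n : ℤ) : ℂ) ^ 2)⁻¹ = 2 * χ⁻¹.LFunction 2 := by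
  have hinv1 : χ⁻¹ (-1) = 1 := by rw [MulChar.inv_apply_eq_inv', heven, inv_one]
  rw [← charRowTwo_zero χ⁻¹ τ hinv1]
  have hF := summable_charRowTwo χ⁻¹ τ 0
  rw [tsum_int_eq_sum_zmod_tsum N hF]
  refine Finset.sum_congr rfl fun x _ ↦ ?_
  rw [← tsum_mul_left, ← (Equiv.neg ℤ).tsum_eq]
  refine tsum_congr fun j ↦ ?_
  rw [Equiv.neg_apply, intCast_mul_add_val, _root_.zpow_neg, zpow_ofNat]
  congr 2
  push_cast
  ring

/-- **The constant terms of `S_χ` at the cusps**: for `χ ≠ 1` even and `γ = (a b; c d) ∈ SL₂(ℤ)`,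
`∑_e χ̄(e) K_{(0,e)γ} = [N ∣ c] · χ(d) · 2N² L(2, χ̄)` (for `N ∤ c` every `e` with `N ∣ ec` is a
non-unit, so `χ̄(e) = 0`; for `N ∣ c` substitute `e ↦ e d⁻¹`).
[cite: BillereyMenares2018, Prop. 4 (M = 1); DiamondShurman2005, §4.6] -/
theorem sum_inv_mul_weierstrassPDivConst (hχ1 : χ ≠ 1) (heven : χ (-1) = 1) (γ : SL(2, ℤ))
    (τ : ℍ) :
    ∑ e : ZMod N, χ⁻¹ e *
        weierstrassPDivConst N (Matrix.vecMul ![0, (e.val : ℤ)] (γ : Matrix (Fin 2) (Fin 2) ℤ)) =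
      if ((γ 1 0 : ℤ) : ZMod N) = 0 then
        χ ((γ 1 1 : ℤ) : ZMod N) * (2 * (N : ℂ) ^ 2 * χ⁻¹.LFunction 2) else 0 := by
  classical
  have h0 : ∑ e : ZMod N, χ⁻¹ e = 0 := MulChar.sum_eq_zero_of_ne_one (inv_ne_one.mpr hχ1)
  -- drop the level-one constant `-2ζ(2)` and read off the entries of `(0,e)γ = (ec, ed)`
  have hstep : ∑ e : ZMod N, χ⁻¹ e *
      weierstrassPDivConst N (Matrix.vecMul ![0, (e.val : ℤ)] (γ : Matrix (Fin 2) (Fin 2) ℤ)) =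
      ∑ e : ZMod N, χ⁻¹ e * (if (N : ℤ) ∣ e.val * γ 1 0 then
        (N : ℂ) ^ 2 * ∑' n : ℤ, (((e.val * γ 1 1 - N * n : ℤ) : ℂ) ^ 2)⁻¹ else 0) := by
    have : ∀ e : ZMod N, χ⁻¹ e *
        weierstrassPDivConst N (Matrix.vecMul ![0, (e.val : ℤ)] (γ : Matrix (Fin 2) (Fin 2) ℤ)) =
        χ⁻¹ e * (if (N : ℤ) ∣ e.val * γ 1 0 then
          (N : ℂ) ^ 2 * ∑' n : ℤ, (((e.val * γ 1 1 - N * n : ℤ) : ℂ) ^ 2)⁻¹ else 0) -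
          χ⁻¹ e * (2 * riemannZeta 2) := by
      intro e
      rw [weierstrassPDivConst, vecMul_fin_two', vecMul_fin_two']
      simp only [Matrix.cons_val_zero, Matrix.cons_val_one, Matrix.cons_val_fin_one, zero_mul,
        zero_add]
      ring
    rw [Finset.sum_congr rfl fun e _ ↦ this e, Finset.sum_sub_distrib, ← Finset.sum_mul, h0,
      zero_mul, sub_zero]
  rw [hstep]
  by_cases hc : ((γ 1 0 : ℤ) : ZMod N) = 0
  · rw [if_pos hc]
    have hdvd : ∀ e : ZMod N, (N : ℤ) ∣ e.val * γ 1 0 := fun e ↦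
      Dvd.dvd.mul_left ((ZMod.intCast_zmod_eq_zero_iff_dvd _ N).1 hc) _
    simp_rw [if_pos (hdvd _)]
    -- `d` is a unit mod `N`
    have hdet : (γ 0 0 : ℤ) * γ 1 1 - γ 0 1 * γ 1 0 = 1 := by
      have := Matrix.SpecialLinearGroup.det_coe γ
      rw [Matrix.det_fin_two] at this
      exact this
    have hd1 : ((γ 0 0 : ℤ) : ZMod N) * ((γ 1 1 : ℤ) : ZMod N) = 1 := by
      have := congrArg ((↑) : ℤ → ZMod N) hdet
      push_cast at this
      rw [hc, mul_zero, sub_zero] at this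
      exact this
    have hu : IsUnit (((γ 1 1 : ℤ) : ZMod N)) := IsUnit.of_mul_eq_one_right _ hd1
    set u : (ZMod N)ˣ := hu.unit with hu_def
    have huval : (u : ZMod N) = ((γ 1 1 : ℤ) : ZMod N) := hu.unit_spec
    -- `K₀(e d) = K₀((e u)~)`
    have hK : ∀ e : ZMod N, ∑' n : ℤ, (((e.val * γ 1 1 - N * n : ℤ) : ℂ) ^ 2)⁻¹ =
        ∑' n : ℤ, ((((e * u).val - N * n : ℤ) : ℂ) ^ 2)⁻¹ := by
      intro e
      refine tsum_inv_sq_congr_mod ?_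
      push_cast
      rw [ZMod.natCast_zmod_val, ZMod.natCast_zmod_val, huval]
    simp_rw [hK]
    have hχu : χ ((γ 1 1 : ℤ) : ZMod N) * χ⁻¹ (u : ZMod N) = 1 := by
      rw [← huval, MulChar.inv_apply_eq_inv']
      have : χ (u : ZMod N) ≠ 0 := fun h ↦ by
        have := congrArg χ hd1
        rw [map_mul, map_one, ← huval] at this
        rw [h, mul_zero] at this
        exact zero_ne_one this
      field_simp
    calc ∑ e : ZMod N, χ⁻¹ e * ((N : ℂ) ^ 2 * ∑' n : ℤ, ((((e * u).val - N * n : ℤ) : ℂ) ^ 2)⁻¹)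
        = χ ((γ 1 1 : ℤ) : ZMod N) * (N : ℂ) ^ 2 * ∑ e : ZMod N,
            χ⁻¹ (e * u) * ∑' n : ℤ, ((((e * u).val - N * n : ℤ) : ℂ) ^ 2)⁻¹ := by
          rw [Finset.mul_sum]
          refine Finset.sum_congr rfl fun e _ ↦ ?_
          rw [map_mul]
          calc χ⁻¹ e * ((N : ℂ) ^ 2 * ∑' n : ℤ, ((((e * u).val - N * n : ℤ) : ℂ) ^ 2)⁻¹)
              = (χ ((γ 1 1 : ℤ) : ZMod N) * χ⁻¹ (u : ZMod N)) * (χ⁻¹ e * ((N : ℂ) ^ 2 *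
                  ∑' n : ℤ, ((((e * u).val - N * n : ℤ) : ℂ) ^ 2)⁻¹)) := by rw [hχu, one_mul]
            _ = _ := by ring
      _ = χ ((γ 1 1 : ℤ) : ZMod N) * (N : ℂ) ^ 2 * ∑ e : ZMod N,
            χ⁻¹ e * ∑' n : ℤ, (((e.val - N * n : ℤ) : ℂ) ^ 2)⁻¹ := by
          congr 1
          exact Fintype.sum_equiv (Units.mulRight u)
            (fun e ↦ χ⁻¹ (e * u) * ∑' n : ℤ, ((((e * u).val - N * n : ℤ) : ℂ) ^ 2)⁻¹)
            (fun e ↦ χ⁻¹ e * ∑' n : ℤ, (((e.val - N * n : ℤ) : ℂ) ^ 2)⁻¹) (fun e ↦ rfl)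
      _ = _ := by
          rw [sum_inv_mul_tsum_inv_sq χ heven τ]
          ring
  · rw [if_neg hc]
    refine Finset.sum_eq_zero fun e _ ↦ ?_
    by_cases hdvd : (N : ℤ) ∣ e.val * γ 1 0
    · -- `e` is not a unit
      have h1 : (e : ZMod N) * ((γ 1 0 : ℤ) : ZMod N) = 0 := by
        have := (ZMod.intCast_zmod_eq_zero_iff_dvd _ N).2 hdvd
        push_cast at this
        rw [ZMod.natCast_zmod_val] at this
        exact this
      have hnu : ¬ IsUnit e := fun heu ↦ hc ((heu.mul_right_eq_zero).mp h1)
      rw [MulChar.map_nonunit _ hnu, zero_mul]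
    · rw [if_neg hdvd, mul_zero]

/-! ### The modular form `E_2^{𝟙,χ}` -/

/-- The normalising constant `(2 (-2πi)² W(χ̄))⁻¹ = (-8π² W(χ̄))⁻¹` turning `S_χ` into `E_2^{𝟙,χ}`.
[cite: DiamondShurman2005, Thm. 4.6.2] -/
def eisensteinE2CharConst : ℂ :=
  (2 * ((-2 * π * Complex.I) ^ 2 * gaussSum χ⁻¹ (ZMod.stdAddChar (N := N))))⁻¹

/-- **`E_2^{𝟙,χ}` as a modular form of weight `2` on `Γ₁(N)`**:
`(2 (-2πi)² W(χ̄))⁻¹ · S_χ` (for `χ` primitive, non-trivial and even this is the Eisenstein series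
with `a_n = σ_1^χ(n)`; for other `χ` it is some modular form of weight `2`).
[cite: DiamondShurman2005, Thm. 4.6.2; Miyake2006, Thm. 7.2.12] -/
def eisensteinE2Char : ModularForm (Gamma1 N) 2 where
  toFun := eisensteinE2CharConst χ • weierstrassPDivChar χ
  slash_action_eq' A hA := by
    obtain ⟨A, (hA : A ∈ Gamma1 N), rfl⟩ := hA
    have h11 : ((A 1 1 : ℤ) : ZMod N) = 1 := ((Gamma1_mem N A).1 hA).2.1
    have h := weierstrassPDivChar_slash_of_mem_gamma0 χ (Gamma1_in_Gamma0 N hA)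
    rw [h11, map_one, one_smul] at h
    show (eisensteinE2CharConst χ • weierstrassPDivChar χ) ∣[(2 : ℤ)] A = _
    rw [ModularForm.SL_smul_slash, h]
  holo' := (mdifferentiable_weierstrassPDivChar χ).const_smul _
  bdd_at_cusps' {c} hc := by
    rw [Subgroup.IsArithmetic.isCusp_iff_isCusp_SL2Z] at hc
    rw [OnePoint.isBoundedAt_iff_forall_SL2Z hc]
    intro γ _
    show IsBoundedAtImInfty ((eisensteinE2CharConst χ • weierstrassPDivChar χ) ∣[(2 : ℤ)] γ)
    rw [ModularForm.SL_smul_slash]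
    exact ((tendsto_weierstrassPDivChar_slash_atImInfty χ γ).const_smul
      (eisensteinE2CharConst χ)).isBigO_one ℝ

/-- The function of `eisensteinE2Char`. [folklore] -/
@[simp] theorem coe_eisensteinE2Char : (⇑(eisensteinE2Char χ) : ℍ → ℂ) =
    eisensteinE2CharConst χ • weierstrassPDivChar χ := rfl

/-- **`E_2^{𝟙,χ} ∣₂ γ = χ(d) E_2^{𝟙,χ}` for `γ = (a b; c d) ∈ Γ₀(N)`** (nebentypus `χ`).
[cite: DiamondShurman2005, Thm. 4.6.2; BillereyMenares2018, §1.3] -/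
theorem eisensteinE2Char_slash_of_mem_gamma0 {γ : SL(2, ℤ)} (hγ : γ ∈ Gamma0 N) :
    (⇑(eisensteinE2Char χ) : ℍ → ℂ) ∣[(2 : ℤ)] γ =
      χ ((γ 1 1 : ℤ) : ZMod N) • (⇑(eisensteinE2Char χ) : ℍ → ℂ) := by
  rw [coe_eisensteinE2Char, ModularForm.SL_smul_slash, weierstrassPDivChar_slash_of_mem_gamma0 χ hγ,
    smul_comm]

/-- The normalising constant is the inverse of a non-zero number (`χ` primitive). [folklore] -/
theorem two_mul_gaussSum_ne_zero (hχ : χ.IsPrimitive) :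
    (2 * ((-2 * π * Complex.I) ^ 2 * gaussSum χ⁻¹ (ZMod.stdAddChar (N := N)))) ≠ 0 := by
  have hW := gaussSum_ne_zero χ⁻¹ (Literature.NumberTheory.LFunctions.isPrimitive_inv χ hχ)
  have hπ : (π : ℂ) ≠ 0 := by exact_mod_cast Real.pi_ne_zero
  simp [hW, hπ, Complex.I_ne_zero]

omit [NeZero N] in
/-- `|σ_1^χ(n)| ≤ n²`, so `n ↦ σ_1^χ(n) qⁿ` is summable for `|q| < 1`. [folklore] -/
theorem summable_twistedSigmaOne_mul_pow {q : ℂ} (hq : ‖q‖ < 1) :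
    Summable fun n : ℕ ↦ (∑ d ∈ n.divisors, χ d * (d : ℂ)) * q ^ n := by
  have hg := summable_pow_mul_geometric_of_norm_lt_one 2 hq
  refine Summable.of_norm_bounded hg.norm fun n ↦ ?_
  rw [norm_mul, norm_mul, norm_pow, norm_pow, Complex.norm_natCast]
  gcongr
  calc ‖∑ d ∈ n.divisors, χ d * (d : ℂ)‖ ≤ ∑ d ∈ n.divisors, ‖χ d * (d : ℂ)‖ := norm_sum_le _ _
    _ ≤ ∑ d ∈ n.divisors, (n : ℝ) := by
        refine Finset.sum_le_sum fun d hd ↦ ?_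
        rw [norm_mul, Complex.norm_natCast]
        calc ‖χ d‖ * (d : ℝ) ≤ 1 * d := by gcongr; exact χ.norm_le_one _
          _ ≤ n := by rw [one_mul]; exact_mod_cast Nat.divisor_le hd
    _ = n.divisors.card * (n : ℝ) := by rw [Finset.sum_const, nsmul_eq_mul]
    _ ≤ n * n := by gcongr; exact_mod_cast Nat.card_divisors_le_self n
    _ = (n : ℝ) ^ 2 := by ring

/-- **The value of `E_2^{𝟙,χ}`** (`χ` primitive, `χ ≠ 1`, even):
`E(τ) = (2(-2πi)²W(χ̄))⁻¹ · 2N²L(2,χ̄) + ∑_{n ≥ 1} σ_1^χ(n) qⁿ`.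
[cite: DiamondShurman2005, Thm. 4.6.2; Miyake2006, Thm. 7.2.12] -/
theorem eisensteinE2Char_apply (hχ : χ.IsPrimitive) (hχ1 : χ ≠ 1) (heven : χ (-1) = 1) (τ : ℍ) :
    eisensteinE2Char χ τ = eisensteinE2CharConst χ * (2 * (N : ℂ) ^ 2 * χ⁻¹.LFunction 2) +
      ∑' n : ℕ+, (∑ d ∈ (n : ℕ).divisors, χ d * (d : ℂ)) *
        cexp (2 * π * Complex.I * τ) ^ (n : ℕ) := by
  have hc := two_mul_gaussSum_ne_zero χ hχ
  have h := weierstrassPDivChar_eq_qExpansion χ τ hχ hχ1 heven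
  show eisensteinE2CharConst χ * weierstrassPDivChar χ τ = _
  rw [h, mul_add, eisensteinE2CharConst, inv_mul_cancel_left₀ hc]

/-- **The `q`-expansion of `E_2^{𝟙,χ}`** (`χ` primitive, `χ ≠ 1`, even) as a `HasSum` over `ℕ` in
`𝕢 = e^{2πiτ}`: `a_0 = (2(-2πi)²W(χ̄))⁻¹ · 2N²L(2,χ̄)`, `a_n = σ_1^χ(n)` for `n ≥ 1`.
[cite: DiamondShurman2005, Thm. 4.6.2; Miyake2006, Thm. 7.2.12] -/
theorem hasSum_qExpansion_eisensteinE2Char (hχ : χ.IsPrimitive) (hχ1 : χ ≠ 1) (heven : χ (-1) = 1)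
    (τ : ℍ) :
    HasSum (fun n : ℕ ↦ (if n = 0 then eisensteinE2CharConst χ * (2 * (N : ℂ) ^ 2 * χ⁻¹.LFunction 2)
        else ∑ d ∈ n.divisors, χ d * (d : ℂ)) • Periodic.qParam 1 τ ^ n)
      (eisensteinE2Char χ τ) := by
  have hq1 : Periodic.qParam 1 τ = cexp (2 * π * Complex.I * τ) := by
    simp [Periodic.qParam]
  have hq : ‖cexp (2 * π * Complex.I * τ)‖ < 1 := norm_exp_two_pi_I_lt_one τ
  have hS : Summable fun n : ℕ ↦ (∑ d ∈ (n + 1).divisors, χ d * (d : ℂ)) *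
      cexp (2 * π * Complex.I * τ) ^ (n + 1) :=
    (summable_nat_add_iff 1).mpr (summable_twistedSigmaOne_mul_pow χ hq)
  rw [← hasSum_nat_add_iff' 1, Finset.sum_range_one, eisensteinE2Char_apply χ hχ hχ1 heven τ,
    tsum_pnat_eq_tsum_succ
      (f := fun n ↦ (∑ d ∈ n.divisors, χ d * (d : ℂ)) * cexp (2 * π * Complex.I * τ) ^ n)]
  simp only [if_true, pow_zero, smul_eq_mul, mul_one, Nat.add_eq_zero_iff, one_ne_zero, and_false,
    if_false, add_sub_cancel_left, hq1]
  exact hS.hasSum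

/-- **`a_n(E_2^{𝟙,χ}) = σ_1^χ(n) = ∑_{d ∣ n} χ(d) d` for `n ≥ 1`.**
[cite: DiamondShurman2005, Thm. 4.6.2; BillereyMenares2018, (7.1.3)] -/
theorem qExpansion_coeff_eisensteinE2Char (hχ : χ.IsPrimitive) (hχ1 : χ ≠ 1) (heven : χ (-1) = 1)
    {n : ℕ} (hn : n ≠ 0) :
    (qExpansion 1 ⇑(eisensteinE2Char χ)).coeff n = ∑ d ∈ n.divisors, χ d * (d : ℂ) := by
  have h1 : (1 : ℝ) ∈ (Gamma1 N : Subgroup (GL (Fin 2) ℝ)).strictPeriods :=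
    strictWidthInfty_Gamma1 N ▸ (Gamma1 N : Subgroup (GL (Fin 2) ℝ)).strictWidthInfty_mem_strictPeriods
  have h := (ModularFormClass.qExpansion_coeff_unique one_pos h1
    (f := eisensteinE2Char χ) (hasSum_qExpansion_eisensteinE2Char χ hχ hχ1 heven) n).symm
  rw [h, if_neg hn]

/-- **The constant term `a_0(E_2^{𝟙,χ}) = -B_{2,χ}/4`**:
`(2(-2πi)²W(χ̄))⁻¹ · 2N² L(2, χ̄) = -B_{2,χ}/4` by `L(2, χ̄) = -(2πi)² B_{2,χ}/(4 N W(χ))` and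
`W(χ) W(χ̄) = χ(-1) N = N`. [cite: BillereyMenares2018, (7.1.3); DiamondShurman2005, §4.7] -/
theorem eisensteinE2CharConst_mul_LFunction_two (hχ : χ.IsPrimitive) (heven : χ (-1) = 1) :
    eisensteinE2CharConst χ * (2 * (N : ℂ) ^ 2 * χ⁻¹.LFunction 2) =
      -(generalizedBernoulli 2 χ) / 4 := by
  have hprim : χ⁻¹.IsPrimitive := Literature.NumberTheory.LFunctions.isPrimitive_inv χ hχ
  have hinv1 : χ⁻¹ (-1) = 1 := by rw [MulChar.inv_apply_eq_inv', heven, inv_one]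
  have hpar : χ⁻¹ (-1) = (-1) ^ 2 := by rw [hinv1]; norm_num
  have hL := LFunction_eq_bernoulli χ⁻¹ hprim (k := 2) le_rfl hpar
  simp only [Nat.cast_ofNat, inv_inv, Nat.factorial, Nat.succ_eq_add_one, Nat.reduceAdd,
    show (2 : ℕ) - 1 = 1 from rfl, pow_one, mul_one] at hL
  have hWbar := gaussSum_ne_zero χ⁻¹ hprim
  have hWW := gaussSum_mul_gaussSum_inv χ hχ
  rw [heven, one_mul] at hWW
  have hW : gaussSum χ (ZMod.stdAddChar (N := N)) =
      N / gaussSum χ⁻¹ (ZMod.stdAddChar (N := N)) := by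
    rw [eq_div_iff hWbar, hWW]
  have hN0 : (N : ℂ) ≠ 0 := by exact_mod_cast NeZero.ne N
  have hπ : (π : ℂ) ≠ 0 := by exact_mod_cast Real.pi_ne_zero
  rw [hL, hW, eisensteinE2CharConst]
  field_simp
  ring

/-- **`a_0(E_2^{𝟙,χ}) = -B_{2,χ}/4`** (`χ` primitive, `χ ≠ 1`, even).
[cite: BillereyMenares2018, (7.1.3); DiamondShurman2005, Thm. 4.6.2] -/
theorem qExpansion_coeff_zero_eisensteinE2Char (hχ : χ.IsPrimitive) (hχ1 : χ ≠ 1)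
    (heven : χ (-1) = 1) :
    (qExpansion 1 ⇑(eisensteinE2Char χ)).coeff 0 = -(generalizedBernoulli 2 χ) / 4 := by
  have h1 : (1 : ℝ) ∈ (Gamma1 N : Subgroup (GL (Fin 2) ℝ)).strictPeriods :=
    strictWidthInfty_Gamma1 N ▸ (Gamma1 N : Subgroup (GL (Fin 2) ℝ)).strictWidthInfty_mem_strictPeriods
  have h := (ModularFormClass.qExpansion_coeff_unique one_pos h1
    (f := eisensteinE2Char χ) (hasSum_qExpansion_eisensteinE2Char χ hχ hχ1 heven) 0).symm
  rw [h, if_pos rfl, eisensteinE2CharConst_mul_LFunction_two χ hχ heven]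

/-- **The constant terms of `E_2^{𝟙,χ}` at the cusps** (`χ` primitive, `χ ≠ 1`, even): for
`γ = (a b; c d) ∈ SL₂(ℤ)`, `E ∣₂ γ → -(B_{2,χ}/4) χ(d)` at `i∞` if `N ∣ c`, and `→ 0` otherwise.
[cite: BillereyMenares2018, Prop. 4 (M = 1)] -/
theorem tendsto_eisensteinE2Char_slash_atImInfty (hχ : χ.IsPrimitive) (hχ1 : χ ≠ 1)
    (heven : χ (-1) = 1) (γ : SL(2, ℤ)) :
    Tendsto ((⇑(eisensteinE2Char χ) : ℍ → ℂ) ∣[(2 : ℤ)] γ) atImInfty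
      (𝓝 (if ((γ 1 0 : ℤ) : ZMod N) = 0 then
        -(generalizedBernoulli 2 χ) / 4 * χ ((γ 1 1 : ℤ) : ZMod N) else 0)) := by
  rw [coe_eisensteinE2Char, ModularForm.SL_smul_slash]
  have h := (tendsto_weierstrassPDivChar_slash_atImInfty χ γ).const_smul (eisensteinE2CharConst χ)
  rw [sum_inv_mul_weierstrassPDivConst χ hχ1 heven γ UpperHalfPlane.I] at h
  have hlim : (eisensteinE2CharConst χ • (if ((γ 1 0 : ℤ) : ZMod N) = 0 then
      χ ((γ 1 1 : ℤ) : ZMod N) * (2 * (N : ℂ) ^ 2 * χ⁻¹.LFunction 2) else 0)) =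
      (if ((γ 1 0 : ℤ) : ZMod N) = 0 then
        -(generalizedBernoulli 2 χ) / 4 * χ ((γ 1 1 : ℤ) : ZMod N) else 0) := by
    rw [smul_eq_mul]
    split_ifs with hc
    · rw [← eisensteinE2CharConst_mul_LFunction_two χ hχ heven]
      ring
    · rw [mul_zero]
  rw [hlim] at h
  exact h

/-- `χ ≠ 1` for a primitive character of level `N ≠ 1`. [folklore] -/
theorem ne_one_of_isPrimitive_of_level_ne_one (hχ : χ.IsPrimitive) (hN1 : N ≠ 1) : χ ≠ 1 := by
  intro h
  apply hN1
  have hc : χ.conductor = N := hχ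
  rw [← hc, h, DirichletCharacter.conductor_one]

/-- **The weight-`2` Eisenstein series `E_2^{𝟙,χ}`** in the shape `(E₂)` used by
`BillereyMenares2018_exists_newform_of_cuspidalLift_of_weightTwoEisenstein`: for `χ` primitive
modulo `N ≠ 1` and even there is a modular form `E` of weight `2` on `Γ₁(N)` with nebentypus `χ`
on `Γ₀(N)`, `a_n(E) = ∑_{d ∣ n} χ(d) d` (`n ≥ 1`), and constant term `-(B_{2,χ}/4) χ(d) [N ∣ c]` at
the cusp `γ∞`, `γ = (a b; c d)`.
[cite: BillereyMenares2018, §1.3 (7.1.3) and Prop. 4; Miyake2006, Thm. 7.2.12;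
DiamondShurman2005, Thm. 4.6.2] -/
theorem exists_weightTwoEisenstein (N : ℕ) [NeZero N] (χ : DirichletCharacter ℂ N)
    (hχ : χ.IsPrimitive) (hN1 : N ≠ 1) (heven : χ (-1) = 1) :
    ∃ E : ModularForm (Gamma1 N) 2,
      (∀ γ : SL(2, ℤ), γ ∈ Gamma0 N →
        (⇑E : ℍ → ℂ) ∣[(2 : ℤ)] γ = χ ((γ 1 1 : ℤ) : ZMod N) • (⇑E : ℍ → ℂ)) ∧
      (∀ n : ℕ, n ≠ 0 → (qExpansion 1 ⇑E).coeff n = ∑ d ∈ n.divisors, χ d * (d : ℂ)) ∧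
      (∀ γ : SL(2, ℤ), Tendsto ((⇑E : ℍ → ℂ) ∣[(2 : ℤ)] γ) atImInfty
        (𝓝 (if ((γ 1 0 : ℤ) : ZMod N) = 0 then
          -(generalizedBernoulli 2 χ) / 4 * χ ((γ 1 1 : ℤ) : ZMod N) else 0))) :=
  have hχ1 := ne_one_of_isPrimitive_of_level_ne_one χ hχ hN1
  ⟨eisensteinE2Char χ, fun _ hγ ↦ eisensteinE2Char_slash_of_mem_gamma0 χ hγ,
    fun _ hn ↦ qExpansion_coeff_eisensteinE2Char χ hχ hχ1 heven hn,
    fun γ ↦ tendsto_eisensteinE2Char_slash_atImInfty χ hχ hχ1 heven γ⟩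

end Literature.NumberTheory.EllipticCurves.ModularForms

/-! ### Billerey–Menares 2018, Thm. 2 (⟸) with Thm. 1, reduced to the cuspidal lift alone -/

namespace Literature.NumberTheory.EllipticCurves

open Literature.NumberTheory.EllipticCurves.ModularForms Literature.NumberTheory.ModularForms
open Literature.NumberTheory.GaloisRepresentations

/-- **Billerey–Menares 2018, Thm. 2 (⟸) with Thm. 1, conditional only on the cuspidal lift (K)**
(Katz's `q`-expansion principle with Carayol's Lemma, §3.2): the weight-`2` Eisenstein input
`(E₂)` of `BillereyMenares2018_exists_newform_of_cuspidalLift_of_weightTwoEisenstein` is now the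
theorem `exists_weightTwoEisenstein`. [cite: BillereyMenares2018, Thm. 1, Thm. 2, §3.2] -/
theorem BillereyMenares2018_exists_newform_of_cuspidalLift
    (hK : ∀ (p : ℕ) [Fact p.Prime], 5 ≤ p → ∀ (ι : PadicAlgCl p ≃+* ℂ) (L : ℕ) [NeZero L],
      ¬ p ∣ L → ∀ (k : ℤ), 2 ≤ k → ∀ (χ : DirichletCharacter ℂ L) (F : ModularForm (Gamma1 L) k),
        χ (-1) = (-1) ^ k → (∃ m : ℕ, 0 < m ∧ ¬ p ∣ m ∧ χ ^ m = 1) →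
        (∀ γ : SL(2, ℤ), γ ∈ Gamma0 L →
          (⇑F : ℍ → ℂ) ∣[k] γ = χ ((γ 1 1 : ℤ) : ZMod L) • (⇑F : ℍ → ℂ)) →
        (∀ n : ℕ, Valued.v (ι.symm ((qExpansion 1 ⇑F).coeff n)) ≤ 1) →
        (∀ γ : SL(2, ℤ), ∃ c : ℂ,
          Tendsto ((⇑F : ℍ → ℂ) ∣[k] γ) atImInfty (𝓝 c) ∧ Valued.v (ι.symm c) < 1) →
        ∃ G : CuspForm (Gamma1 L) k, G ∈ nebentypusSubspace L k χ ∧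
          ∀ n : ℕ, Valued.v (ι.symm ((qExpansion 1 ⇑G).coeff n - (qExpansion 1 ⇑F).coeff n)) < 1) :
    BillereyMenares2018_exists_newform :=
  BillereyMenares2018_exists_newform_of_cuspidalLift_of_weightTwoEisenstein hK
    (fun N _ χ hχ hN1 heven ↦ exists_weightTwoEisenstein N χ hχ hN1 heven)

/-- The same, from the cuspidal lift in the (stronger) shape `hlift` used for Billerey–Menares 2016
(`BillereyMenares2016_thm22_of_cuspFormLift`: no parity / order hypotheses on `χ`).
[cite: BillereyMenares2018, Thm. 1, Thm. 2, §3.2] -/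
theorem BillereyMenares2018_exists_newform_of_cuspFormLift
    (hlift : ∀ (p : ℕ) [Fact p.Prime], 5 ≤ p → ∀ (ι : PadicAlgCl p ≃+* ℂ) (N : ℕ) [NeZero N],
      ¬ p ∣ N → ∀ (k : ℤ), 2 ≤ k → ∀ (χ : DirichletCharacter ℂ N) (F : ModularForm (Gamma1 N) k),
      (∀ γ : SL(2, ℤ), γ ∈ Gamma0 N →
        (⇑F : ℍ → ℂ) ∣[k] γ = χ ((γ 1 1 : ℤ) : ZMod N) • (⇑F : ℍ → ℂ)) →
      (∀ n : ℕ, Valued.v (ι.symm ((qExpansion 1 ⇑F).coeff n)) ≤ 1) →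
      (∀ γ : SL(2, ℤ), ∃ c : ℂ,
        Tendsto ((⇑F : ℍ → ℂ) ∣[k] γ) atImInfty (𝓝 c) ∧ Valued.v (ι.symm c) < 1) →
      ∃ G : CuspForm (Gamma1 N) k, G ∈ nebentypusSubspace N k χ ∧
        ∀ n : ℕ, Valued.v (ι.symm ((qExpansion 1 ⇑G).coeff n - (qExpansion 1 ⇑F).coeff n)) < 1) :
    BillereyMenares2018_exists_newform :=
  BillereyMenares2018_exists_newform_of_cuspidalLift
    (fun p _ hp ι L _ hpL k hk χ F _ _ hsl hint hcusp ↦ hlift p hp ι L hpL k hk χ F hsl hint hcusp)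

end Literature.NumberTheory.EllipticCurves
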